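import Mathlib
import Literature.NumberTheory.LFunctions.Zhang2022.Section5Lemma53CaseTwo
import Literature.Analysis.Complex.HolomorphicParametricIntegral
import HarnessLib

/-!
# Zhang (2022), §5 (5.14): "As a consequence of Lemma 5.3, the Mellin transform
# `δ(s) := ∫₀^∞ Δ(x)x^{s−1} dx` is analytic for `σ > 0`", kernel-checked

Topic `Literature/NumberTheory/LFunctions/Zhang2022` (Landau–Siegel autopsy tree; verdict-neutral).
Y. Zhang, *Discrete mean estimates and the Landau–Siegel zero*, arXiv:2211.02515v1 (2022) — **an
unrefereed manuscript, a claimed result under adjudication** (cell pub-zhang: audit + repair census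
of arXiv:2211.02515; no claim about Landau–Siegel).

Glossary: `\l` = `𝓛 = log D`; `𝓛₂ = 𝓛^{400}` ((2.15)); `Δ` is (5.10) (`Lemma53.Delta510`, = (5.6)–(5.7)
by `Section5DeltaMellin`). Source text, §5 p. 11:

> As a consequence of Lemma 5.3, the Mellin transform
> `δ(s) := ∫₀^∞ Δ(x)x^{s−1} dx`   (5.14)
> is analytic for `σ > 0`.

This file PROVES it for free reals `L₂ ≥ 1`, `t₀` (the manuscript's values are not needed):

* `Lemma53.norm_Delta510_le` — the trivial bound `|Δ(x)| ≤ e^{1/(16L₂²)}√π/L₂` for all real `x`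
  (`|e^{phase(u)}| = e^{u/2 − L₂²u²}`), which controls `x → 0⁺`;
* `Lemma53.exists_norm_Delta510_le_rpow_neg` — **super-polynomial decay**: for every `k : ℕ` there is
  `C` with `|Δ(x)| ≤ C·x^{−k}` for `x ≥ 1` — from the explicit (5.9) of `Section5Lemma53CaseTwo` with
  `c = 1/2`, `X = √x` (`e^{−(L₂ log x)²/4} ≤ e^{k²}x^{−k}`, `e^{−√x/L₂} ≤ (2k)!·L₂^{2k}·x^{−k}`), and the
  trivial bound below the threshold `√x ≤ 2t₀`;
* `Lemma53.integrableOn_norm_Delta510_mul_rpow` — `∫₀^∞ |Δ(x)|x^{a−1} dx < ∞` for every `a > 0`;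
* `Lemma53.delta514` — (5.14); **`Lemma53.differentiableOn_delta514`** — `δ` is holomorphic on
  `{Re s > 0}` (holomorphy of dominated parameter integrals, the tree's
  `Literature.Analysis.Complex.differentiableOn_integral_of_dominated`, with the local majorant
  `|Δ(x)|(x^{σ₀/2−1} + x^{3σ₀/2−1})` on the ball of radius `σ₀/2` about `s₀`).

Lemma 5.4 (the bounds (i)/(ii) for `δ`) is not addressed here. Nothing about Theorems 1–2 of the
source is stated or implied; nothing here bears on the cell's verdict on (8.24).

## References

* Y. Zhang, arXiv:2211.02515v1 (2022), §5 p. 11, (5.14). [cite: Zhang2022LandauSiegel, §5 (5.14)]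
-/

noncomputable section

open Complex Real Set MeasureTheory Filter Topology

namespace Literature.NumberTheory.LFunctions.Zhang2022

namespace Lemma53

/-! ## The trivial bound and continuity of `Δ` -/

/-- `∫_ℝ e^{u/2 − L₂²u²} du = e^{1/(16L₂²)}·√π/L₂`. [folklore] -/
private lemma integral_exp_half_sub_sq'' {L₂ : ℝ} (hL : 0 < L₂) :
    ∫ u : ℝ, Real.exp (u / 2 - L₂ ^ 2 * u ^ 2)
      = Real.exp (1 / (16 * L₂ ^ 2)) * (Real.sqrt π / L₂) := by
  have hL2 : 0 < L₂ ^ 2 := by positivity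
  have e : (fun u : ℝ => Real.exp (u / 2 - L₂ ^ 2 * u ^ 2))
      = fun u : ℝ => Real.exp (1 / (16 * L₂ ^ 2))
          * (fun y : ℝ => Real.exp (-(L₂ ^ 2) * y ^ 2)) (u - 1 / (4 * L₂ ^ 2)) := by
    funext u
    simp only
    rw [← Real.exp_add]
    congr 1
    field_simp
    ring
  rw [e, MeasureTheory.integral_const_mul,
    integral_sub_right_eq_self (fun y : ℝ => Real.exp (-(L₂ ^ 2) * y ^ 2)) (1 / (4 * L₂ ^ 2)),
    integral_gaussian, Real.sqrt_div' _ hL2.le, Real.sqrt_sq hL.le]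

/-- **The trivial bound**: `|Δ(x)| ≤ e^{1/(16L₂²)}√π/L₂` for every real `x` (`L₂ > 0`), since
`|e^{phase(u)}| = e^{u/2 − L₂²u²}`. [cite: Zhang2022LandauSiegel, §5 (5.10)] -/
theorem norm_Delta510_le {L₂ : ℝ} (hL : 0 < L₂) (t₀ x : ℝ) :
    ‖Delta510 L₂ t₀ x‖ ≤ Real.exp (1 / (16 * L₂ ^ 2)) * (Real.sqrt π / L₂) := by
  rw [Delta510, ← integral_exp_half_sub_sq'' hL]
  calc ‖∫ u : ℝ, cexp (phase L₂ t₀ x u)‖ ≤ ∫ u : ℝ, ‖cexp (phase L₂ t₀ x u)‖ :=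
        norm_integral_le_integral_norm _
    _ = ∫ u : ℝ, Real.exp (u / 2 - L₂ ^ 2 * u ^ 2) := by
        congr 1; funext u; exact norm_cexp_phase_ofReal L₂ t₀ x u

/-- `Δ` is continuous (indeed differentiable, `hasDerivAt_Delta510`). [cite: Zhang2022LandauSiegel, §5 (5.10)] -/
theorem continuous_Delta510 {L₂ : ℝ} (hL : L₂ ≠ 0) (t₀ : ℝ) : Continuous (Delta510 L₂ t₀) :=
  continuous_iff_continuousAt.mpr fun x => (hasDerivAt_Delta510 hL t₀ x).continuousAt

/-! ## Super-polynomial decay of `Δ(x)` as `x → ∞` -/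

/-- `e^{−(log x)²/4} ≤ e^{k²}·x^{−k}` for `x > 0` (AM–GM in the exponent). [folklore] -/
private lemma exp_neg_log_sq_le {x : ℝ} (hx : 0 < x) (k : ℝ) :
    Real.exp (-((Real.log x) ^ 2 / 4)) ≤ Real.exp (k ^ 2) * x ^ (-k) := by
  rw [Real.rpow_def_of_pos hx, ← Real.exp_add]
  apply Real.exp_le_exp.mpr
  nlinarith [sq_nonneg (Real.log x / 2 - k)]

/-- `e^{−y} ≤ n!·y^{−n}` for `y > 0`. [folklore] -/
private lemma exp_neg_le_factorial_mul {y : ℝ} (hy : 0 < y) (n : ℕ) :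
    Real.exp (-y) ≤ (n.factorial : ℝ) * y ^ (-(n : ℝ)) := by
  have h := Real.pow_div_factorial_le_exp y hy.le n
  have hfac : (0 : ℝ) < n.factorial := by exact_mod_cast Nat.factorial_pos n
  rw [div_le_iff₀ hfac] at h
  rw [Real.rpow_neg hy.le, Real.rpow_natCast, Real.exp_neg]
  have hyn : 0 < y ^ n := pow_pos hy n
  rw [inv_le_iff_one_le_mul₀ (Real.exp_pos y)]
  calc (1 : ℝ) = y ^ n * (y ^ n)⁻¹ := by field_simp
    _ ≤ (Real.exp y * n.factorial) * (y ^ n)⁻¹ := by gcongr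
    _ = n.factorial * (y ^ n)⁻¹ * Real.exp y := by ring

/-- **Super-polynomial decay**: for `L₂ ≥ 1`, every `k : ℕ` admits a constant `C` with
`|Δ(x)| ≤ C·x^{−k}` for all `x ≥ 1` (from (5.9) with `c = 1/2`, `X = √x`, and the trivial bound
while `√x ≤ 2t₀`). [cite: Zhang2022LandauSiegel, §5 Lemma 5.3 (5.9), (5.14)] -/
theorem exists_norm_Delta510_le_rpow_neg {L₂ : ℝ} (hL : 1 ≤ L₂) (t₀ : ℝ) (k : ℕ) :
    ∃ C : ℝ, 0 ≤ C ∧ ∀ x : ℝ, 1 ≤ x → ‖Delta510 L₂ t₀ x‖ ≤ C * x ^ (-(k : ℝ)) := by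
  have hL0 : 0 < L₂ := by linarith
  -- constants
  set M : ℝ := Real.exp (1 / (16 * L₂ ^ 2)) * (Real.sqrt π / L₂) with hM
  have hM0 : 0 ≤ M := by positivity
  set x₀ : ℝ := max 1 (4 * t₀ ^ 2 + 1) with hx₀
  have hx₀1 : 1 ≤ x₀ := le_max_left _ _
  set C₁ : ℝ := (2 + Real.exp 1 / L₂) * Real.exp ((k : ℝ) ^ 2) with hC₁
  set C₂ : ℝ := Real.exp (1 + 1 / (16 * L₂ ^ 2)) * (Real.sqrt π / L₂)
    * (((2 * k).factorial : ℝ) * L₂ ^ (2 * k)) with hC₂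
  set C₃ : ℝ := M * x₀ ^ (k : ℝ) with hC₃
  refine ⟨C₁ + C₂ + C₃, by positivity, fun x hx1 => ?_⟩
  have hx0 : 0 < x := by linarith
  have hxk : 0 < x ^ (-(k : ℝ)) := Real.rpow_pos_of_pos hx0 _
  by_cases hxx : x₀ < x
  · -- the decay range: apply (5.9) with `c = 1/2`, `X = √x`
    have hsx : 0 < Real.sqrt x := Real.sqrt_pos.mpr hx0
    have ht : 2 * t₀ < Real.sqrt x := by
      have h4 : 4 * t₀ ^ 2 + 1 ≤ x₀ := le_max_right _ _
      have : 4 * t₀ ^ 2 < x := by linarith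
      calc 2 * t₀ ≤ |2 * t₀| := le_abs_self _
        _ = Real.sqrt ((2 * t₀) ^ 2) := (Real.sqrt_sq_eq_abs _).symm
        _ < Real.sqrt x := Real.sqrt_lt_sqrt (sq_nonneg _) (by nlinarith)
    have hc : 0 ≤ 1 / 2 * Real.log x := by
      have := Real.log_nonneg hx1; positivity
    have hX : Real.sqrt x ≤ x * Real.exp (-(1 / 2 * Real.log x)) := by
      have e1 : Real.exp (-(1 / 2 * Real.log x)) = x ^ (-(1 / 2 : ℝ)) := by
        rw [Real.rpow_def_of_pos hx0]; congr 1; ring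
      rw [e1, Real.sqrt_eq_rpow,
        show x * x ^ (-(1 / 2 : ℝ)) = x ^ (1 : ℝ) * x ^ (-(1 / 2 : ℝ)) by rw [Real.rpow_one],
        ← Real.rpow_add hx0]
      norm_num
    have hmain := norm_Delta510_le_caseTwo hL t₀ hx0.le hc hsx hX ht
    -- the Gaussian-in-log terms
    have hlog : Real.exp (-(1 / 2 * L₂ * Real.log x) ^ 2)
        ≤ Real.exp ((k : ℝ) ^ 2) * x ^ (-(k : ℝ)) := by
      have h1 : Real.exp (-(1 / 2 * L₂ * Real.log x) ^ 2) ≤ Real.exp (-((Real.log x) ^ 2 / 4)) := by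
        apply Real.exp_le_exp.mpr
        have hL2 : 1 ≤ L₂ ^ 2 := one_le_pow₀ hL
        nlinarith [sq_nonneg (Real.log x), mul_le_mul_of_nonneg_right hL2 (sq_nonneg (Real.log x))]
      exact h1.trans (exp_neg_log_sq_le hx0 k)
    have hT12 : 2 * Real.exp (-(1 / 2 * L₂ * Real.log x) ^ 2)
          + Real.exp (1 - (1 / 2 * L₂ * Real.log x) ^ 2) / L₂
        ≤ C₁ * x ^ (-(k : ℝ)) := by
      have e2 : Real.exp (1 - (1 / 2 * L₂ * Real.log x) ^ 2) / L₂
          = Real.exp 1 / L₂ * Real.exp (-(1 / 2 * L₂ * Real.log x) ^ 2) := by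
        rw [sub_eq_add_neg, Real.exp_add]; ring
      rw [e2, hC₁]
      have hpos : 0 ≤ Real.exp 1 / L₂ := by positivity
      nlinarith [hlog, mul_le_mul_of_nonneg_left hlog hpos]
    -- the `e^{−√x/L₂}` term
    have hT3 : Real.exp (-(Real.sqrt x / L₂))
        ≤ ((2 * k).factorial : ℝ) * L₂ ^ (2 * k) * x ^ (-(k : ℝ)) := by
      have h := exp_neg_le_factorial_mul (y := Real.sqrt x / L₂) (by positivity) (2 * k)
      have e : (Real.sqrt x / L₂) ^ (-((2 * k : ℕ) : ℝ)) = L₂ ^ (2 * k) * x ^ (-(k : ℝ)) := by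
        rw [Real.rpow_neg (by positivity), Real.rpow_natCast, div_pow, pow_mul,
          Real.sq_sqrt hx0.le, Real.rpow_neg hx0.le, Real.rpow_natCast]
        field_simp
      rw [e, ← mul_assoc] at h
      exact h
    have hT3' : Real.exp (1 + 1 / (16 * L₂ ^ 2)) * (Real.sqrt π / L₂) * Real.exp (-(Real.sqrt x / L₂))
        ≤ C₂ * x ^ (-(k : ℝ)) := by
      rw [hC₂, mul_assoc (Real.exp (1 + 1 / (16 * L₂ ^ 2)) * (Real.sqrt π / L₂))]
      exact mul_le_mul_of_nonneg_left hT3 (by positivity)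
    have h3 : 0 ≤ C₃ * x ^ (-(k : ℝ)) := by positivity
    calc ‖Delta510 L₂ t₀ x‖ ≤ _ := hmain
      _ ≤ C₁ * x ^ (-(k : ℝ)) + C₂ * x ^ (-(k : ℝ)) := add_le_add hT12 hT3'
      _ ≤ (C₁ + C₂ + C₃) * x ^ (-(k : ℝ)) := by nlinarith
  · -- the compact range `1 ≤ x ≤ x₀`: trivial bound
    have hxx : x ≤ x₀ := not_lt.mp hxx
    have h1 : ‖Delta510 L₂ t₀ x‖ ≤ M := norm_Delta510_le hL0 t₀ x
    have h2 : M ≤ C₃ * x ^ (-(k : ℝ)) := by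
      rw [hC₃, mul_assoc]
      have : 1 ≤ x₀ ^ (k : ℝ) * x ^ (-(k : ℝ)) := by
        rw [Real.rpow_neg hx0.le, ← div_eq_mul_inv, one_le_div (Real.rpow_pos_of_pos hx0 _)]
        exact Real.rpow_le_rpow hx0.le hxx (Nat.cast_nonneg k)
      nlinarith
    have h3 : 0 ≤ (C₁ + C₂) * x ^ (-(k : ℝ)) := by positivity
    nlinarith


/-! ## Absolute convergence of (5.14) for `σ > 0` -/

/-- The integrand `x ↦ |Δ(x)|·x^{a−1}` is continuous on `(0, ∞)`. [folklore] -/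
private lemma continuousOn_norm_mul_rpow {L₂ : ℝ} (hL : L₂ ≠ 0) (t₀ a : ℝ) :
    ContinuousOn (fun x : ℝ => ‖Delta510 L₂ t₀ x‖ * x ^ (a - 1)) (Ioi 0) := by
  intro x hx
  have h1 : ContinuousAt (fun x : ℝ => ‖Delta510 L₂ t₀ x‖) x :=
    ((continuous_Delta510 hL t₀).continuousAt).norm
  have h2 : ContinuousAt (fun x : ℝ => x ^ (a - 1)) x :=
    Real.continuousAt_rpow_const x (a - 1) (Or.inl (ne_of_gt hx))
  exact (h1.mul h2).continuousWithinAt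

/-- **`∫₀^∞ |Δ(x)| x^{a−1} dx < ∞` for every `a > 0`** (`L₂ ≥ 1`): near `0` by the trivial bound,
near `∞` by the super-polynomial decay. [cite: Zhang2022LandauSiegel, §5 (5.14)] -/
theorem integrableOn_norm_Delta510_mul_rpow {L₂ : ℝ} (hL : 1 ≤ L₂) (t₀ : ℝ) {a : ℝ} (ha : 0 < a) :
    IntegrableOn (fun x : ℝ => ‖Delta510 L₂ t₀ x‖ * x ^ (a - 1)) (Ioi 0) := by
  have hL0 : 0 < L₂ := by linarith
  set M : ℝ := Real.exp (1 / (16 * L₂ ^ 2)) * (Real.sqrt π / L₂) with hM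
  have hcont := continuousOn_norm_mul_rpow hL0.ne' t₀ a
  rw [← Ioc_union_Ioi_eq_Ioi zero_le_one]
  refine IntegrableOn.union ?_ ?_
  · -- `(0, 1]`
    have hrpow : IntegrableOn (fun x : ℝ => M * x ^ (a - 1)) (Ioc 0 1) := by
      have := intervalIntegral.intervalIntegrable_rpow' (a := 0) (b := 1) (r := a - 1) (by linarith)
      exact ((intervalIntegrable_iff_integrableOn_Ioc_of_le zero_le_one).mp this).const_mul M
    refine hrpow.mono' ((hcont.mono Ioc_subset_Ioi_self).aestronglyMeasurable measurableSet_Ioc) ?_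
    filter_upwards [ae_restrict_mem measurableSet_Ioc] with x hx
    have hxa : 0 ≤ x ^ (a - 1) := Real.rpow_nonneg hx.1.le _
    rw [Real.norm_of_nonneg (mul_nonneg (norm_nonneg _) hxa)]
    exact mul_le_mul_of_nonneg_right (norm_Delta510_le hL0 t₀ x) hxa
  · -- `(1, ∞)`
    obtain ⟨C, hC0, hC⟩ := exists_norm_Delta510_le_rpow_neg hL t₀ (⌈a⌉₊ + 1)
    set k : ℕ := ⌈a⌉₊ + 1 with hk
    have hk1 : a - 1 + -(k : ℝ) < -1 := by
      have := Nat.le_ceil a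
      rw [hk]; push_cast; linarith
    have hrpow : IntegrableOn (fun x : ℝ => C * x ^ (a - 1 + -(k : ℝ))) (Ioi 1) :=
      (integrableOn_Ioi_rpow_of_lt hk1 zero_lt_one).const_mul C
    refine hrpow.mono' ((hcont.mono (Ioi_subset_Ioi zero_le_one)).aestronglyMeasurable
      measurableSet_Ioi) ?_
    filter_upwards [ae_restrict_mem measurableSet_Ioi] with x hx
    have hx1 : 1 ≤ x := le_of_lt hx
    have hx0 : 0 < x := by linarith
    have hxa : 0 ≤ x ^ (a - 1) := Real.rpow_nonneg hx0.le _
    rw [Real.norm_of_nonneg (mul_nonneg (norm_nonneg _) hxa), Real.rpow_add hx0]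
    calc ‖Delta510 L₂ t₀ x‖ * x ^ (a - 1) ≤ C * x ^ (-(k : ℝ)) * x ^ (a - 1) :=
          mul_le_mul_of_nonneg_right (hC x hx1) hxa
      _ = C * (x ^ (a - 1) * x ^ (-(k : ℝ))) := by ring

/-- **(5.14)**: `δ(s) = ∫₀^∞ Δ(x)x^{s−1} dx`. [cite: Zhang2022LandauSiegel, §5 (5.14)] -/
def delta514 (L₂ t₀ : ℝ) (s : ℂ) : ℂ := ∫ x in Ioi (0 : ℝ), Delta510 L₂ t₀ x * (x : ℂ) ^ (s - 1)

/-- The integrand of (5.14) is continuous on `(0, ∞)` for each `s`. [folklore] -/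
private lemma continuousOn_integrand {L₂ : ℝ} (hL : L₂ ≠ 0) (t₀ : ℝ) (s : ℂ) :
    ContinuousOn (fun x : ℝ => Delta510 L₂ t₀ x * (x : ℂ) ^ (s - 1)) (Ioi 0) := by
  intro x hx
  have h1 : ContinuousAt (Delta510 L₂ t₀) x := (continuous_Delta510 hL t₀).continuousAt
  have h2 : ContinuousAt (fun x : ℝ => (x : ℂ) ^ (s - 1)) x := by
    have hslit : (x : ℂ) ∈ Complex.slitPlane := by
      rw [Complex.mem_slitPlane_iff]; left; simpa using hx
    exact (continuousAt_cpow_const hslit).comp Complex.continuous_ofReal.continuousAt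
  exact (h1.mul h2).continuousWithinAt

/-- **(5.14) converges absolutely for `σ > 0`.** [cite: Zhang2022LandauSiegel, §5 (5.14)] -/
theorem integrableOn_Delta510_mul_cpow {L₂ : ℝ} (hL : 1 ≤ L₂) (t₀ : ℝ) {s : ℂ} (hs : 0 < s.re) :
    IntegrableOn (fun x : ℝ => Delta510 L₂ t₀ x * (x : ℂ) ^ (s - 1)) (Ioi 0) := by
  have hL0 : 0 < L₂ := by linarith
  refine (integrableOn_norm_Delta510_mul_rpow hL t₀ hs).mono'
    ((continuousOn_integrand hL0.ne' t₀ s).aestronglyMeasurable measurableSet_Ioi) ?_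
  filter_upwards [ae_restrict_mem measurableSet_Ioi] with x hx
  rw [norm_mul, Complex.norm_cpow_eq_rpow_re_of_pos hx, sub_re, one_re]

/-- `x^t ≤ x^p + x^q` for `x > 0` and `p ≤ t ≤ q`. [folklore] -/
private lemma rpow_le_rpow_add_rpow {x p q t : ℝ} (hx : 0 < x) (hpt : p ≤ t) (htq : t ≤ q) :
    x ^ t ≤ x ^ p + x ^ q := by
  rcases le_or_gt 1 x with h1 | h1
  · have := Real.rpow_le_rpow_of_exponent_le h1 htq
    linarith [Real.rpow_nonneg hx.le p]
  · have := Real.rpow_le_rpow_of_exponent_ge hx h1.le hpt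
    linarith [Real.rpow_nonneg hx.le q]

/-- **"the Mellin transform `δ(s)` … is analytic for `σ > 0`"**: `δ` is holomorphic on `{Re s > 0}`
(`L₂ ≥ 1`; dominated holomorphic parameter integral with local majorant
`|Δ(x)|(x^{σ₀/2−1} + x^{3σ₀/2−1})` on `ball s₀ (σ₀/2)`). [cite: Zhang2022LandauSiegel, §5 (5.14)] -/
theorem differentiableOn_delta514 {L₂ : ℝ} (hL : 1 ≤ L₂) (t₀ : ℝ) :
    DifferentiableOn ℂ (delta514 L₂ t₀) {s : ℂ | 0 < s.re} := by
  have hL0 : 0 < L₂ := by linarith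
  refine Literature.Analysis.Complex.differentiableOn_integral_of_dominated
    (μ := (volume : Measure ℝ).restrict (Ioi 0))
    (F := fun (s : ℂ) (x : ℝ) => Delta510 L₂ t₀ x * (x : ℂ) ^ (s - 1)) ?_ ?_ ?_
  · intro s _
    exact (continuousOn_integrand hL0.ne' t₀ s).aestronglyMeasurable measurableSet_Ioi
  · filter_upwards [ae_restrict_mem measurableSet_Ioi] with x hx
    intro s _
    have hx0 : (x : ℂ) ≠ 0 := ofReal_ne_zero.mpr (ne_of_gt hx)
    exact (((differentiableAt_id.sub_const 1).const_cpow (Or.inl hx0)).const_mul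
      (Delta510 L₂ t₀ x)).differentiableWithinAt
  · intro s₀ hs₀
    have hσ : 0 < s₀.re := hs₀
    refine ⟨s₀.re / 2, half_pos hσ, ?_, fun x => ‖Delta510 L₂ t₀ x‖
      * (x ^ (s₀.re / 2 - 1) + x ^ (3 * s₀.re / 2 - 1)), ?_, ?_⟩
    · intro s hs
      have h1 : |(s - s₀).re| ≤ ‖s - s₀‖ := Complex.abs_re_le_norm _
      have h2 : ‖s - s₀‖ < s₀.re / 2 := by rwa [← dist_eq_norm]
      rw [Complex.sub_re] at h1
      show 0 < s.re
      have := neg_abs_le (s.re - s₀.re)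
      linarith
    · have h1 := integrableOn_norm_Delta510_mul_rpow hL t₀ (a := s₀.re / 2) (half_pos hσ)
      have h2 := integrableOn_norm_Delta510_mul_rpow hL t₀ (a := 3 * s₀.re / 2) (by linarith)
      exact (h1.add h2).congr (Eventually.of_forall fun x => by simp only [Pi.add_apply]; ring)
    · filter_upwards [ae_restrict_mem measurableSet_Ioi] with x hx
      intro s hs
      have h1 : |(s - s₀).re| ≤ ‖s - s₀‖ := Complex.abs_re_le_norm _
      have h2 : ‖s - s₀‖ < s₀.re / 2 := by rwa [← dist_eq_norm]
      rw [Complex.sub_re] at h1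
      obtain ⟨hlo, hhi⟩ := abs_le.mp (h1.trans h2.le)
      rw [norm_mul, Complex.norm_cpow_eq_rpow_re_of_pos hx, sub_re, one_re]
      exact mul_le_mul_of_nonneg_left
        (rpow_le_rpow_add_rpow hx (by linarith) (by linarith)) (norm_nonneg _)

end Lemma53

end Literature.NumberTheory.LFunctions.Zhang2022
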